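import Summits.QuantumFields.YangMills.Theorems.PencilRigidityNPointIsotropyOneAngleSkew
import Summits.QuantumFields.YangMills.Theorems.LangevinControlUVOSLegsFromFemtoAndGapStubUpgrade

/-!
# One-angle amplification, III: moving the skew axis to a coordinate axis (two circles and the IVT)

Support file (pure Euclidean geometry of `ℝ⁴`; registered sub-goal `oneAngleAxis` of stub `stub_oneAngleAmplification`,
crux `stmt-QuantumFields-11686` `Summit.QuantumFields.YangMills.Theses.PencilRigidity.NPointIsotropy`, line
`quarter-turn-corner-operator`). Namespace `…NPointIsotropy.QuarterTurnCornerOperator`, helpers in the sub-namespace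
`OneAngle`; no `def`, no notation. `E4 = EuclideanSpace ℝ (Fin 4)`, `ρ t = planeRot (d := 3) 0 t`.

**Main theorem** `oneAngleAxis`. Let `P` be a predicate on the linear isometries of `ℝ⁴`, closed under composition
and inverses, holding on every proper signed permutation, and holding on every determinant-one isometry fixing `e₃`
and the vector `v = e₀ + (1+√2) e₁ + e₂` (the circle group about `v`, delivered by file II `oneAngleCircle`). Then
`P` holds on every determinant-one isometry fixing `e₂` and `e₃` (the coordinate `SO(2)₀₁`, i.e. the quantifier
of `PlanarInvariant`).

Informal proof. It suffices to find `g ∈ P` with `g e₃ = e₃` and `g v = c e₂` (`c = ‖v‖`): conjugation by `g`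
turns a determinant-one isometry fixing `e₂, e₃` into one fixing `v, e₃`. Take a frame `P₀` (fixing `e₃`,
`P₀ v = c e₂`; file I `OneAngle.exists_frame`); the rotations `ρ_v(β) = P₀⁻¹ ρ(β) P₀` about `v` lie in `P`, hence so
do the rotations `σ(β) = o ∘ ρ_v(β) ∘ o⁻¹` about `o v`, where `o = ρ(π/2) ∈ P` is the quarter-turn. The function
`f(β) = ⟪σ(β) v, v⟫` is continuous, `f(0) = ‖v‖² = c² ≥ c` and `f(π) = 2⟪o v, v⟫²/c² - c² = 2/c² - c² ≤ c`
(`⟪o v, v⟫ = 1`, `c² = 5 + 2√2 ≥ 3`), so by the intermediate value theorem `f(β) = c = ⟪c e₂, v⟫` for some `β`;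
then `x = σ(β) v` and `w = c e₂` have equal norms, equal inner products with `v`, and are `⊥ e₃`, so the
reflection in `x - w` followed by the reflection in `(1+√2) e₀ - e₁` (a vector `⊥ v, e₂, e₃`) is a
determinant-one isometry fixing `v, e₃` (hence in `P`) mapping `x ↦ w` (`OneAngle.exists_fix_axis_map`).
Composing, `g = R₁ ∘ σ(β) ∈ P` does the job. (A limit-free shortcut is impossible: the countable group generated
by the hypotheses contains no element moving `v/‖v‖` to `e₂`, both circles are needed.)

References: folklore (Euler-angle type generation of `SO(3)` by two circle subgroups).
-/

noncomputable section

namespace Summit.QuantumFields.YangMills.Theorems.NPointIsotropy.QuarterTurnCornerOperator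

open scoped InnerProductSpace Topology
open Literature.MathematicalPhysics.QuantumFieldTheory
open Summit.QuantumFields.YangMills.Theorems.NPointIsotropy.Negative (E4)
open Summit.QuantumFields.YangMills.Theorems.PlanarToEuclidean
open Summit.QuantumFields.YangMills.Theorems.OSLegsFromFemtoAndGap.Upgrade

namespace OneAngle

/-! ### Coordinates, norms and inner products in `ℝ⁴` -/

/-- `⟪ρ(π) y, y⟫ = -y₀² - y₁² + y₂² + y₃²` for the half-turn of the `(x₀,x₁)`-plane. [folklore] -/
theorem inner_rho_pi_self (y : E4) :
    ⟪planeRot (d := 3) 0 Real.pi y, y⟫_ℝ = -(y 0) ^ 2 - (y 1) ^ 2 + (y 2) ^ 2 + (y 3) ^ 2 := by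
  rw [PiLp.inner_apply, Fin.sum_univ_four]
  simp [planeRot_apply, Real.cos_pi, Real.sin_pi, Fin.succ_zero_eq_one]
  ring

/-- `‖y‖² = y₀² + y₁² + y₂² + y₃²`. [folklore] -/
theorem norm_sq_eq_four (y : E4) : ‖y‖ ^ 2 = (y 0) ^ 2 + (y 1) ^ 2 + (y 2) ^ 2 + (y 3) ^ 2 := by
  rw [EuclideanSpace.norm_sq_eq, Fin.sum_univ_four]
  simp [sq_abs]

/-- The rotation `t ↦ ρ(t) y` of a fixed vector is continuous in the angle. [folklore] -/
theorem continuous_rho_apply (y : E4) : Continuous fun t : ℝ => planeRot (d := 3) 0 t y :=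
  (continuous_apply (0 : Fin 1)).comp
    ((continuous_rho_diag (n := 1)).comp (continuous_id.prodMk (continuous_const (y := fun _ : Fin 1 => y))))

/-- Adjunction for a linear isometric isomorphism: `⟪o a, b⟫ = ⟪a, o⁻¹ b⟫`. [folklore] -/
theorem inner_map_eq_inner_symm (o : E4 ≃ₗᵢ[ℝ] E4) (a b : E4) : ⟪o a, b⟫_ℝ = ⟪a, o.symm b⟫_ℝ := by
  rw [← o.inner_map_map a (o.symm b), LinearIsometryEquiv.apply_symm_apply]

/-! ### Two reflections: the circle group about an axis acts transitively on its parallels -/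

/-- **Transitivity on a parallel.** For the axis `v = e₀ + (1+√2) e₁ + e₂`: if `x, w ⊥ e₃` have the same norm and
the same inner product with `v`, and `w` is a multiple of `e₂`, then some determinant-one isometry fixing `v` and
`e₃` maps `x` to `w` — the reflection in `x - w` followed by the reflection in `(1+√2) e₀ - e₁ ⊥ v, e₂, e₃`
(or the identity if `x = w`). [folklore] -/
theorem exists_fix_axis_map (x : E4) (c : ℝ)
    (hnorm : ‖x‖ = ‖c • (EuclideanSpace.single 2 1 : E4)‖)
    (hinner : ⟪x, EuclideanSpace.single 0 1 + (1 + Real.sqrt 2) • EuclideanSpace.single 1 1 +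
        EuclideanSpace.single 2 1⟫_ℝ = c)
    (hx3 : x 3 = 0) :
    ∃ R₁ : E4 ≃ₗᵢ[ℝ] E4, LinearMap.det (R₁.toLinearEquiv : E4 →ₗ[ℝ] E4) = 1 ∧
      R₁ (EuclideanSpace.single 0 1 + (1 + Real.sqrt 2) • EuclideanSpace.single 1 1 + EuclideanSpace.single 2 1) =
        EuclideanSpace.single 0 1 + (1 + Real.sqrt 2) • EuclideanSpace.single 1 1 + EuclideanSpace.single 2 1 ∧
      R₁ (EuclideanSpace.single 3 1) = EuclideanSpace.single 3 1 ∧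
      R₁ x = c • EuclideanSpace.single 2 1 := by
  set v : E4 := EuclideanSpace.single 0 1 + (1 + Real.sqrt 2) • EuclideanSpace.single 1 1 +
    EuclideanSpace.single 2 1 with hv
  set w : E4 := c • EuclideanSpace.single 2 1 with hw
  by_cases hxw : x = w
  · refine ⟨LinearIsometryEquiv.refl ℝ E4, ?_, rfl, rfl, hxw⟩
    have h : ((LinearIsometryEquiv.refl ℝ E4).toLinearEquiv : E4 →ₗ[ℝ] E4) = LinearMap.id := rfl
    rw [h, LinearMap.det_id]
  set z₀ : E4 := (1 + Real.sqrt 2) • EuclideanSpace.single 0 1 - EuclideanSpace.single 1 1 with hz₀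
  have hz₀ne : z₀ ≠ 0 := fun h0 => by
    have h1 : z₀ 1 = 0 := by rw [h0]; rfl
    simp [hz₀] at h1
  have hz₀v : ⟪z₀, v⟫_ℝ = 0 := by
    rw [hz₀, hv, PiLp.inner_apply, Fin.sum_univ_four]
    simp
  have hz₀w : ⟪z₀, w⟫_ℝ = 0 := by
    rw [hz₀, hw, PiLp.inner_apply, Fin.sum_univ_four]
    simp
  have hz₀3 : ⟪z₀, EuclideanSpace.single 3 1⟫_ℝ = 0 := by
    rw [hz₀, PiLp.inner_apply, Fin.sum_univ_four]
    simp
  have hwv : ⟪w, v⟫_ℝ = c := by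
    rw [hw, hv, PiLp.inner_apply, Fin.sum_univ_four]
    simp
  have hxwv : ⟪x - w, v⟫_ℝ = 0 := by rw [inner_sub_left, hinner, hwv, sub_self]
  have hxw3 : ⟪x - w, EuclideanSpace.single 3 1⟫_ℝ = 0 := by
    rw [inner_sub_left, real_inner_comm, inner_e_left, hx3, real_inner_comm, inner_e_left, hw]
    simp
  refine ⟨((Submodule.span ℝ {x - w})ᗮ.reflection).trans ((Submodule.span ℝ {z₀})ᗮ.reflection),
    det_refl_trans_refl (sub_ne_zero.2 hxw) hz₀ne, ?_, ?_, ?_⟩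
  · rw [LinearIsometryEquiv.trans_apply, refl_fix hxwv, refl_fix hz₀v]
  · rw [LinearIsometryEquiv.trans_apply, refl_fix hxw3, refl_fix hz₀3]
  · rw [LinearIsometryEquiv.trans_apply, refl_sub_left hnorm, refl_fix hz₀w]

/-! ### Generation: moving the skew axis to `e₂` -/

section Generation

variable (P : (E4 ≃ₗᵢ[ℝ] E4) → Prop)

/-- **From the circle group about `v` to the stabiliser of `e₂, e₃`.** Let `P` be closed under composition and
inverses, hold on the proper signed permutations, and hold on every determinant-one isometry fixing `e₃` and
`v = e₀ + (1+√2) e₁ + e₂`. Then `P` holds on every determinant-one isometry fixing `e₂` and `e₃`.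
Proof: in a frame `P₀` with `P₀ v = c e₂` (`OneAngle.exists_frame`) the rotations `ρ_v(β) = P₀⁻¹ρ(β)P₀` about `v`
satisfy `P`, hence so do the rotations `σ(β) = o ρ_v(β) o⁻¹` about `o v`, `o = ρ(π/2)` the quarter-turn; the
continuous function `β ↦ ⟪σ(β) v, v⟫` is `‖v‖² ≥ c` at `0` and `2/c² - c² ≤ c` at `π` (`c = ‖v‖ ≥ 1`), so by the
intermediate value theorem some `σ(β) v` has inner product `c = ⟪c e₂, v⟫` with `v`, and two reflections fixing
`v, e₃` (`OneAngle.exists_fix_axis_map`) carry it to `c e₂`: an element `g` of `P` with `g v = c e₂`, `g e₃ = e₃`.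
Conjugating by `g` turns the stabiliser of `(e₂, e₃)` into that of `(v, e₃)`. [folklore] -/
theorem axis_of_circle (hmul : ∀ A B, P A → P B → P (A.trans B)) (hinv : ∀ A, P A → P A.symm)
    (hhyper : ∀ A : E4 ≃ₗᵢ[ℝ] E4, LinearMap.det (A.toLinearEquiv : E4 →ₗ[ℝ] E4) = 1 →
      (∀ i : Fin 4, ∃ j : Fin 4, A (EuclideanSpace.single i 1) = EuclideanSpace.single j 1 ∨
        A (EuclideanSpace.single i 1) = -EuclideanSpace.single j 1) → P A)
    (hcirc : ∀ R : E4 ≃ₗᵢ[ℝ] E4, LinearMap.det (R.toLinearEquiv : E4 →ₗ[ℝ] E4) = 1 →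
      R (EuclideanSpace.single 0 1 + (1 + Real.sqrt 2) • EuclideanSpace.single 1 1 + EuclideanSpace.single 2 1) =
        EuclideanSpace.single 0 1 + (1 + Real.sqrt 2) • EuclideanSpace.single 1 1 + EuclideanSpace.single 2 1 →
      R (EuclideanSpace.single 3 1) = EuclideanSpace.single 3 1 → P R)
    (R : E4 ≃ₗᵢ[ℝ] E4) (hR : LinearMap.det (R.toLinearEquiv : E4 →ₗ[ℝ] E4) = 1)
    (hR2 : R (EuclideanSpace.single 2 1) = EuclideanSpace.single 2 1)
    (hR3 : R (EuclideanSpace.single 3 1) = EuclideanSpace.single 3 1) : P R := by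
  set v : E4 := EuclideanSpace.single 0 1 + (1 + Real.sqrt 2) • EuclideanSpace.single 1 1 +
    EuclideanSpace.single 2 1 with hv
  have hs2 : 0 ≤ Real.sqrt 2 := Real.sqrt_nonneg 2
  -- coordinates of `v`
  have hv2 : v 2 = 1 := by simp [hv]
  have hv3 : v 3 = 0 := by simp [hv]
  have hv0 : v ≠ 0 := by
    intro h0
    have h1 : v 0 = 0 := by rw [h0]; rfl
    simp [hv] at h1
  have hvn : 3 ≤ ‖v‖ ^ 2 := by
    rw [norm_sq_eq_four]
    simp [hv]
    nlinarith [hs2]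
  -- the quarter-turn `o = ρ(π/2)` (a proper signed permutation) lies in `P`
  obtain ⟨o, hPo, ho0, ho1, ho2, ho3⟩ : ∃ o : E4 ≃ₗᵢ[ℝ] E4, P o ∧
      o (EuclideanSpace.single 0 1) = -EuclideanSpace.single 1 1 ∧
      o (EuclideanSpace.single 1 1) = EuclideanSpace.single 0 1 ∧
      o (EuclideanSpace.single 2 1) = EuclideanSpace.single 2 1 ∧
      o (EuclideanSpace.single 3 1) = EuclideanSpace.single 3 1 := by
    refine ⟨planeRot (d := 3) 0 (Real.pi / 2), hhyper _ (det_rho _) fun i => ?_, rho_pi_div_two_e0,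
      rho_pi_div_two_e1, rho_e2 _, rho_e3 _⟩
    fin_cases i
    exacts [⟨1, Or.inr rho_pi_div_two_e0⟩, ⟨0, Or.inl rho_pi_div_two_e1⟩, ⟨2, Or.inl (rho_e2 _)⟩,
      ⟨3, Or.inl (rho_e3 _)⟩]
  have hov : ⟪o v, v⟫_ℝ = 1 := by
    have h1 : o v = (1 + Real.sqrt 2) • EuclideanSpace.single 0 1 - EuclideanSpace.single 1 1 +
        EuclideanSpace.single 2 1 := by
      simp only [hv, map_add, map_smul, ho0, ho1, ho2]
      ext j
      fin_cases j <;> simp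
    rw [h1, hv, PiLp.inner_apply, Fin.sum_univ_four]
    simp
  have ho3' : o.symm (EuclideanSpace.single 3 1) = EuclideanSpace.single 3 1 := by
    rw [← ho3, LinearIsometryEquiv.symm_apply_apply, ho3]
  -- an adapted frame and the circle group about `v`
  obtain ⟨P₀, -, hP3, c, hc, hPv⟩ := exists_frame v hv3 hv0
  have hcn : c = ‖v‖ := by
    have h := congrArg (fun u : E4 => ‖u‖) hPv
    simp only [LinearIsometryEquiv.norm_map, norm_smul, Real.norm_of_nonneg hc.le] at h
    rw [h, PiLp.norm_single, norm_one, mul_one]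
  have hc1 : 1 ≤ c := by nlinarith [hcn, hvn, hc]
  have hP3' : P₀.symm (EuclideanSpace.single 3 1) = EuclideanSpace.single 3 1 := by
    rw [← hP3, LinearIsometryEquiv.symm_apply_apply, hP3]
  have hPv' : P₀.symm (c • EuclideanSpace.single 2 1) = v := by
    rw [← hPv, LinearIsometryEquiv.symm_apply_apply]
  have hρv : ∀ β : ℝ, ((P₀.trans (planeRot (d := 3) 0 β)).trans P₀.symm) v = v := fun β => by
    rw [LinearIsometryEquiv.trans_apply, LinearIsometryEquiv.trans_apply, hPv, map_smul, rho_e2, hPv']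
  have hρ3 : ∀ β : ℝ, ((P₀.trans (planeRot (d := 3) 0 β)).trans P₀.symm) (EuclideanSpace.single 3 1) =
      EuclideanSpace.single 3 1 := fun β => by
    rw [LinearIsometryEquiv.trans_apply, LinearIsometryEquiv.trans_apply, hP3, rho_e3, hP3']
  have hρdet : ∀ β : ℝ, LinearMap.det (((P₀.trans (planeRot (d := 3) 0 β)).trans P₀.symm).toLinearEquiv :
      E4 →ₗ[ℝ] E4) = 1 := fun β => by
    have h : (P₀.trans (planeRot (d := 3) 0 β)).trans P₀.symm = P₀.trans ((planeRot (d := 3) 0 β).trans P₀.symm) := by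
      ext x : 1
      rfl
    rw [h, det_conj, det_rho]
  have hPρ : ∀ β : ℝ, P ((P₀.trans (planeRot (d := 3) 0 β)).trans P₀.symm) := fun β =>
    hcirc _ (hρdet β) (hρv β) (hρ3 β)
  -- the conjugate circle about `o v` and the function `β ↦ ⟪σ(β) v, v⟫`
  set y : E4 := P₀ (o.symm v) with hy
  have hy3 : y 3 = 0 := by
    rw [← inner_e_left, hy, ← hP3, LinearIsometryEquiv.inner_map_map, ← ho3', LinearIsometryEquiv.inner_map_map,
      inner_e_left, hv3]
  have hy2 : y 2 = c⁻¹ := by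
    have h2 : (EuclideanSpace.single 2 1 : E4) = P₀ (c⁻¹ • v) := by
      rw [map_smul, hPv, smul_smul, inv_mul_cancel₀ hc.ne', one_smul]
    rw [← inner_e_left, hy, h2, LinearIsometryEquiv.inner_map_map, real_inner_smul_left,
      ← inner_map_eq_inner_symm, hov, mul_one]
  have hyn : ‖y‖ = ‖v‖ := by rw [hy, LinearIsometryEquiv.norm_map, LinearIsometryEquiv.norm_map]
  set f : ℝ → ℝ := fun β => ⟪o (P₀.symm (planeRot (d := 3) 0 β y)), v⟫_ℝ with hf
  have hfc : Continuous f :=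
    Continuous.inner (o.continuous.comp (P₀.symm.continuous.comp (continuous_rho_apply y))) continuous_const
  have hf0 : f 0 = ‖v‖ ^ 2 := by
    simp only [hf]
    rw [planeRot_zero_apply, hy, LinearIsometryEquiv.symm_apply_apply, LinearIsometryEquiv.apply_symm_apply,
      real_inner_self_eq_norm_sq]
  have hfπ : f Real.pi = 2 * c⁻¹ ^ 2 - ‖v‖ ^ 2 := by
    simp only [hf]
    rw [inner_map_eq_inner_symm, inner_map_eq_inner_symm, LinearIsometryEquiv.symm_symm, ← hy,
      inner_rho_pi_self, hy3, hy2]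
    have h := norm_sq_eq_four y
    rw [hyn, hy3, hy2] at h
    linarith
  -- intermediate value theorem: some `σ(β) v` has inner product `c` with `v`
  have hle1 : f Real.pi ≤ c := by
    rw [hfπ]
    have h1 : c⁻¹ ^ 2 ≤ 1 := by
      rw [inv_pow]
      exact inv_le_one_of_one_le₀ (by nlinarith)
    nlinarith [hcn, hvn]
  have hle2 : c ≤ f 0 := by
    rw [hf0, ← hcn]
    nlinarith
  obtain ⟨β, -, hβ⟩ : ∃ β ∈ Set.Icc (0 : ℝ) Real.pi, f β = c :=
    intermediate_value_Icc' Real.pi_pos.le hfc.continuousOn ⟨hle1, hle2⟩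
  -- the element `σ = o ∘ ρ_v(β) ∘ o⁻¹` of `P` and the vector `x = σ v`
  set σ : E4 ≃ₗᵢ[ℝ] E4 := o.symm.trans (((P₀.trans (planeRot (d := 3) 0 β)).trans P₀.symm).trans o) with hσ
  have hPσ : P σ := hmul _ _ (hinv _ hPo) (hmul _ _ (hPρ β) hPo)
  have hσ3 : σ (EuclideanSpace.single 3 1) = EuclideanSpace.single 3 1 := by
    rw [hσ, LinearIsometryEquiv.trans_apply, LinearIsometryEquiv.trans_apply, ho3', hρ3, ho3]
  set x : E4 := σ v with hx
  have hxf : ⟪x, v⟫_ℝ = c := hβ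
  have hxn : ‖x‖ = ‖c • (EuclideanSpace.single 2 1 : E4)‖ := by
    rw [hx, LinearIsometryEquiv.norm_map, ← hPv, LinearIsometryEquiv.norm_map]
  have hx3 : x 3 = 0 := by
    rw [← inner_e_left, hx, ← hσ3, LinearIsometryEquiv.inner_map_map, inner_e_left, hv3]
  obtain ⟨R₁, hR₁det, hR₁v, hR₁3, hR₁x⟩ := exists_fix_axis_map x c hxn hxf hx3
  have hPR₁ : P R₁ := hcirc R₁ hR₁det hR₁v hR₁3
  -- `g = R₁ ∘ σ ∈ P` moves the axis `v` to `c e₂`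
  set g : E4 ≃ₗᵢ[ℝ] E4 := σ.trans R₁ with hg
  have hPg : P g := hmul _ _ hPσ hPR₁
  have hgv : g v = c • EuclideanSpace.single 2 1 := by rw [hg, LinearIsometryEquiv.trans_apply, ← hx, hR₁x]
  have hg3 : g (EuclideanSpace.single 3 1) = EuclideanSpace.single 3 1 := by
    rw [hg, LinearIsometryEquiv.trans_apply, hσ3, hR₁3]
  -- conjugate the stabiliser of `(e₂, e₃)` into that of `(v, e₃)`
  set C : E4 ≃ₗᵢ[ℝ] E4 := g.trans (R.trans g.symm) with hC
  have hCv : C v = v := by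
    rw [hC, LinearIsometryEquiv.trans_apply, LinearIsometryEquiv.trans_apply, hgv, map_smul, hR2, ← hgv,
      LinearIsometryEquiv.symm_apply_apply]
  have hC3 : C (EuclideanSpace.single 3 1) = EuclideanSpace.single 3 1 := by
    rw [hC, LinearIsometryEquiv.trans_apply, LinearIsometryEquiv.trans_apply, hg3, hR3, ← hg3,
      LinearIsometryEquiv.symm_apply_apply, hg3]
  have hCdet : LinearMap.det (C.toLinearEquiv : E4 →ₗ[ℝ] E4) = 1 := by rw [hC, det_conj, hR]
  have hPC : P C := hcirc C hCdet hCv hC3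
  rw [eq_symm_trans_conj_trans g R, ← hC]
  exact hmul _ _ (hinv _ hPg) (hmul _ _ hPC hPg)

end Generation

end OneAngle

/-- **Registered sub-goal `oneAngleAxis` of stub `stub_oneAngleAmplification`** (= `OneAngle.axis_of_circle` over
Mathlib vocabulary): a predicate on the linear isometries of `ℝ⁴` closed under composition and inverses, holding on
the proper signed permutations and on every determinant-one isometry fixing `e₃` and `e₀ + (1+√2) e₁ + e₂`, holds
on every determinant-one isometry fixing `e₂` and `e₃`. [folklore] -/
theorem oneAngleAxis :
    ∀ (P : (EuclideanSpace ℝ (Fin 4) ≃ₗᵢ[ℝ] EuclideanSpace ℝ (Fin 4)) → Prop),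
      (∀ A B, P A → P B → P (A.trans B)) → (∀ A, P A → P A.symm) →
      (∀ A : EuclideanSpace ℝ (Fin 4) ≃ₗᵢ[ℝ] EuclideanSpace ℝ (Fin 4),
        LinearMap.det (A.toLinearEquiv : EuclideanSpace ℝ (Fin 4) →ₗ[ℝ] EuclideanSpace ℝ (Fin 4)) = 1 →
        (∀ i : Fin 4, ∃ j : Fin 4, A (EuclideanSpace.single i 1) = EuclideanSpace.single j 1 ∨
          A (EuclideanSpace.single i 1) = -EuclideanSpace.single j 1) → P A) →
      (∀ R : EuclideanSpace ℝ (Fin 4) ≃ₗᵢ[ℝ] EuclideanSpace ℝ (Fin 4),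
        LinearMap.det (R.toLinearEquiv : EuclideanSpace ℝ (Fin 4) →ₗ[ℝ] EuclideanSpace ℝ (Fin 4)) = 1 →
        R (EuclideanSpace.single 0 1 + (1 + Real.sqrt 2) • EuclideanSpace.single 1 1 + EuclideanSpace.single 2 1) =
          EuclideanSpace.single 0 1 + (1 + Real.sqrt 2) • EuclideanSpace.single 1 1 + EuclideanSpace.single 2 1 →
        R (EuclideanSpace.single 3 1) = EuclideanSpace.single 3 1 → P R) →
      ∀ R : EuclideanSpace ℝ (Fin 4) ≃ₗᵢ[ℝ] EuclideanSpace ℝ (Fin 4),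
        LinearMap.det (R.toLinearEquiv : EuclideanSpace ℝ (Fin 4) →ₗ[ℝ] EuclideanSpace ℝ (Fin 4)) = 1 →
        R (EuclideanSpace.single 2 1) = EuclideanSpace.single 2 1 →
        R (EuclideanSpace.single 3 1) = EuclideanSpace.single 3 1 → P R :=
  fun P hmul hinv hhyper hcirc R hR hR2 hR3 => OneAngle.axis_of_circle P hmul hinv hhyper hcirc R hR hR2 hR3

end Summit.QuantumFields.YangMills.Theorems.NPointIsotropy.QuarterTurnCornerOperator

end
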